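import Summits.HodgeConjecture.HodgeConjecture.Theorems.MarkmanPartnerTransportPicardThreeK3SquaresHighPicard
import Summits.HodgeConjecture.HodgeConjecture.Theorems.MarkmanPartnerTransportPicardThreeK3SquaresSquareOfGenerator
import Literature.AlgebraicGeometry.Surfaces.K3SurfaceBuskinLeaves

/-!
# Route MarkmanPartnerTransport · crux `PicardThreeK3Squares` (stmt-HodgeConjecture-19652) —
# the cup-product leaf of Buskin's Theorem 1.1 discharged; the crux's named-fact base made explicit

The reductions of this crux landed so far (`…CMThird`, `…SectorIff`, `…HighPicard`) are modulo
Buskin's Thm. 1.1 (`Buskin2019_hodgeIsometry_algebraic`) and the existence of markings. In the tree,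
Buskin's theorem is assembled from four named leaves
(`Buskin2019_hodgeIsometry_algebraic_holds_of`, `Surfaces/K3SurfaceBuskinLeaves`): Prop. 6.2 for
reflective isometries (`Buskin2019_reflectiveHodgeIsometry_algebraic`, the XL geometric core: Mukai
moduli spaces and hyperholomorphic transport), the multiplicativity of algebraic classes on triple
products of surfaces (`cupProduct_mem_algebraicClasses_tripleProduct_surfaces`), the surjectivity of the
period map in projective form (`Huybrechts_K3_periodSurjective_projective`) and markings
(`Huybrechts_K3_marking_exists`). The second leaf is now a THEOREM:

* `cupProduct_mem_algebraicClasses_tripleProduct_surfaces_holds` — DISCHARGE of the named fact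
  `Surfaces.cupProduct_mem_algebraicClasses_tripleProduct_surfaces` (`N² ∪ N² ⊆ N⁴` on `A ⊗ (B ⊗ C)`
  for smooth projective surfaces): it is VERBATIM the theorem
  `SquareOfGenerator.cupProduct_mem_algebraicClasses_tripleProduct` of `Theorems/…SquareOfGenerator`
  (diagonal pull-back of exterior products with the PROVED `fulton1998_map_mem_algebraicClasses_holds`,
  as in `Voisin2003_cupProduct_algebraicClasses_holds`).
* `buskin2019_hodgeIsometry_algebraic_of_three_leaves` — Buskin's Thm. 1.1 from the THREE remaining
  leaves.
* `picardThreeK3Squares_of_leaves` — the crux `PicardThreeK3Squares` from: the reflective leaf, period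
  surjectivity, markings, and the cycle-induced sector clause on non-CM, non-scalar K3 surfaces with
  `3 ≤ ρ(S) ≤ 16` (`HighPicard.picardThreeK3Squares_of_realMultiplicationThird_le_sixteen`) — the
  crux's complete named-fact base in the tree as of this file.

No definition, no sorry. Prover seat hodge-nonav-19652-p1 (gen 0), `--supports stmt-HodgeConjecture-19652`.

References: Buskin, J. reine angew. Math. 755 (2019), Thm. 1.1, §6.2 (Prop. 6.2, Lemma 6.3); Voisin,
*Hodge Theory and Complex Algebraic Geometry II*, Prop. 9.20; Fulton, *Intersection Theory*, §19.2.
-/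

set_option linter.dupNamespace false

noncomputable section

namespace Summit.HodgeConjecture.HodgeConjecture.Theorems

open CategoryTheory MonoidalCategory CartesianMonoidalCategory
open Literature.AlgebraicGeometry Literature.AlgebraicGeometry.Motives Literature.AlgebraicGeometry.HodgeTheory
open Literature.AlgebraicGeometry.Surfaces
open Literature.AlgebraicTopology.SingularHomology

/-- **The cup-product leaf of Buskin's Theorem 1.1, DISCHARGED**: the named fact
`Surfaces.cupProduct_mem_algebraicClasses_tripleProduct_surfaces` — for smooth projective complex
surfaces `A`, `B`, `C`, `N²H⁴ ∪ N²H⁴ ⊆ N⁴H⁸` on `(A ⊗ (B ⊗ C))(ℂ)` — holds: verbatim the theorem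
`SquareOfGenerator.cupProduct_mem_algebraicClasses_tripleProduct` (the instance
`(dim; codim, codim) = (6; 2, 2)` of the multiplicativity of algebraic classes, proved by diagonal
pull-back of exterior products with `fulton1998_map_mem_algebraicClasses_holds`).
[cite: VoisinHodgeII2003, §9.2.4 Prop. 9.20] [cite: Fulton1998, §19.2] -/
theorem cupProduct_mem_algebraicClasses_tripleProduct_surfaces_holds :
    cupProduct_mem_algebraicClasses_tripleProduct_surfaces :=
  MarkmanPartnerTransport.SquareOfGenerator.cupProduct_mem_algebraicClasses_tripleProduct

namespace MarkmanPartnerTransport.BuskinLeaves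

/-- `Corr[μ, hS ; γ, y] = pr₁_*(pr₂^* y ∪ γ)` on `H²(S(ℂ); ℂ)`. Local notation only. -/
local notation3 (prettyPrint := false) "Corr[" μ ", " hS " ; " γ ", " y "]" =>
  complexGysin μ (IsSmoothProjective.tensor_holds hS hS) hS
    (SemiCartesianMonoidalCategory.fst _ _) (rfl : 2 * 1 + 2 * 2 + 2 * 2 = 2 * 1 + 2 * (2 + 2))
    (cupProduct (rfl : 2 * 1 + 2 * 2 = 2 * 1 + 2 * 2)
      (complexBetti.map (SemiCartesianMonoidalCategory.snd _ _) (2 * 1) y) γ)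

/-- **Buskin's Theorem 1.1 from its three remaining named leaves**: Prop. 6.2 for reflective
isometries, the surjectivity of the period map (projective form) and the existence of markings — the
cup-product leaf being `cupProduct_mem_algebraicClasses_tripleProduct_surfaces_holds`.
[cite: Buskin2019, Thm. 1.1 and §6.2] [cite: Huybrechts2019, §1.1] -/
theorem buskin2019_hodgeIsometry_algebraic_of_three_leaves
    (hrefl : Buskin2019_reflectiveHodgeIsometry_algebraic)
    (hper : Huybrechts_K3_periodSurjective_projective) (hmark : Huybrechts_K3_marking_exists) :
    Buskin2019_hodgeIsometry_algebraic :=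
  Buskin2019_hodgeIsometry_algebraic_holds_of hrefl cupProduct_mem_algebraicClasses_tripleProduct_surfaces_holds
    hper hmark

/-- **The crux `PicardThreeK3Squares` from its complete named-fact base in the tree**: Buskin's
Prop. 6.2 for reflective isometries (`Buskin2019_reflectiveHodgeIsometry_algebraic`), the surjectivity
of the K3 period map in projective form (`Huybrechts_K3_periodSurjective_projective`), the existence of
markings (`Huybrechts_K3_marking_exists`) — three PUBLISHED results typed as named facts — and the ONE
open statement: the cycle-induced sector clause ("every element of `End_Hdg(T(S))` is the restriction
of an `N¹`-stable algebraic correspondence") for non-CM, non-scalar projective K3 surfaces with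
`3 ≤ ρ(S) ≤ 16` (real multiplication; van Geemen–Schütt's cycle-induced families satisfy it,
`SquareOfGenerator.hodgeConjectureFor_tensor_self_of_generated`).
[cite: Buskin2019, Thm. 1.1] [cite: Vangeemen2008, Lemma 3.2] [cite: Varesco2023, §2 (p. 8)] -/
theorem picardThreeK3Squares_of_leaves (hrefl : Buskin2019_reflectiveHodgeIsometry_algebraic)
    (hper : Huybrechts_K3_periodSurjective_projective) (hmark : Huybrechts_K3_marking_exists)
    (hRM : ∀ (S : SchemeOver ℂ) (hS : IsK3Surface S), ¬ HasComplexMultiplication S →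
      3 ≤ Module.finrank ℂ ↥(algebraicClasses S 1) → Module.finrank ℂ ↥(algebraicClasses S 1) ≤ 16 →
      (¬ ∀ (f : complexBetti S (2 * 1) →ₗ[ℂ] complexBetti S (2 * 1)),
        (∀ y, IsRationalClass y → IsRationalClass (f y)) →
        (∀ (i j : ℕ) y, IsOfHodgeType 2 S (2 * 1) i j y → IsOfHodgeType 2 S (2 * 1) i j (f y)) →
        (∀ d ∈ algebraicClasses S 1, f d = 0) →
        (∀ y : complexBetti S (2 * 1), ∀ d ∈ algebraicClasses S 1,
          cupProduct (rfl : 2 * 1 + 2 * 1 = 2 * 2) (f y) d = 0) →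
        ∃ a : ℚ, ∀ y : complexBetti S (2 * 1),
          (∀ d ∈ algebraicClasses S 1, cupProduct (rfl : 2 * 1 + 2 * 1 = 2 * 2) y d = 0) →
            f y = (a : ℂ) • y) →
      ∀ (f : complexBetti S (2 * 1) →ₗ[ℂ] complexBetti S (2 * 1)),
        (∀ y, IsRationalClass y → IsRationalClass (f y)) →
        (∀ (i j : ℕ) y, IsOfHodgeType 2 S (2 * 1) i j y → IsOfHodgeType 2 S (2 * 1) i j (f y)) →
        (∀ d ∈ algebraicClasses S 1, f d = 0) →
        (∀ y : complexBetti S (2 * 1), ∀ d ∈ algebraicClasses S 1,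
          cupProduct (rfl : 2 * 1 + 2 * 1 = 2 * 2) (f y) d = 0) →
        ∃ g : complexBetti S (2 * 1) →ₗ[ℂ] complexBetti S (2 * 1),
          (∀ d ∈ algebraicClasses S 1, g d ∈ algebraicClasses S 1) ∧
          (∃ γ ∈ algebraicClasses (S ⊗ S) 2, ∀ y : complexBetti S (2 * 1),
            g y = Corr[complexOrientationFamily, hS.isSmoothProjective ; γ, y]) ∧
          ∀ y : complexBetti S (2 * 1),
            (∀ d ∈ algebraicClasses S 1, cupProduct (rfl : 2 * 1 + 2 * 1 = 2 * 2) y d = 0) →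
              f y = g y) :
    Summit.HodgeConjecture.HodgeConjecture.Theses.MarkmanPartnerTransport.PicardThreeK3Squares :=
  HighPicard.picardThreeK3Squares_of_realMultiplicationThird_le_sixteen
    (buskin2019_hodgeIsometry_algebraic_of_three_leaves hrefl hper hmark) hmark hRM

end MarkmanPartnerTransport.BuskinLeaves

end Summit.HodgeConjecture.HodgeConjecture.Theorems

end
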